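import Literature.ComputerArithmetic.GraillatJezequelPicot2018.CompensatedSumDot

/-!
# Summation and dot product "as in `K`-fold precision" — `SumK` and `DotK` — under rounding to
nearest and under a directed rounding (Graillat–Jézéquel–Picot 2018, §§7–8)

HONEST FRAMING (ENGINES group, unit `eng-quad-4`, kernels lane of the `certquad` engine — shared
numerical engines serving client cells; rigour lives in the verifiers; every published number
belongs to a client cell's ledger, not to the engines group): the kernels' cascaded compensated
sums and dot products (`K` passes of the error-free vector transformation, then a plain sum) run
both under rounding to nearest and under a directed rounding. This file types and PROVES, in the
MODEL of `CompensatedSumDot.lean` (which it imports and whose engine lemmas it reuses), the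
published ACCURACY bounds of those runs: LEMMA 4.9 and §§7–8 of the source, listed there as
"NOT formalised". No hardware, vendor, timing or format claims; the format-level facts of the
source (the standard model of one rounded operation, eq. (2.2); the exactness of `PriestTwoSum`
under any rounding mode, §4.3; the exactness of `TwoProdFMA` barring underflow, §5.2) are
HYPOTHESES here, to be discharged per format elsewhere.

Source read at the page: [GraillatJezequelPicot2018] (Appl. Math. Comput. 329 (2018) 339–363),
§4.3 (Algorithms 4–5 `PriestTwoSum` / `PriestCompSum`, LEMMA 4.9, PROPOSITION 4.10 and its proof,
eqs. (4.6)–(4.12)), §7 (Algorithm 12 `SumK`; PROPOSITION 7.1 and COROLLARY 7.2, recalled there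
from [20] = Ogita–Rump–Oishi 2005; LEMMA 7.3, eqs. (7.37)–(7.40); PROPOSITION 7.4;
COROLLARY 7.5) and §8 (Algorithms 13–14 `DotK`; PROPOSITION 8.1 and COROLLARY 8.2, recalled from
[20]; PROPOSITION 8.3 and its proof, eqs. (8.42)–(8.49); COROLLARY 8.4). The numbering is the
journal's.

THE MODEL (ordered field `K`; as in `CompensatedSumDot.lean`).
* `v ≥ 0` bounds the relative error of ONE rounded operation in the additive form
  `|fl(t) - t| ≤ v |t|` (§2 eq. (2.2)): `v = u` under rounding to nearest, `v = 2u` under a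
  directed rounding. Every rounded operation is a TRACE hypothesis on arbitrary sequences, so ONE
  theorem is PROPOSITION 7.1 / 8.1 (`v = u`) and PROPOSITION 7.4 / 8.3 (`v = 2u`) at once: the
  source's proofs of 7.4 / 8.3 are the proofs of [20] with `u` replaced by `2u`, and that is
  literally what the trace form does.
* The vector transformation of ONE pass (Algorithm 12, lines 2–4, with `PriestTwoSum`) is EXACT
  (`w = 0` in the notation of `CompensatedSumDot.lean`): the new vector consists of the exact
  addition errors and the last running sum — `IsVecSumPass` below. `TwoProdFMA` is exact, so the
  product residuals of `DotK` are the exact `xᵢ yᵢ - hᵢ`.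
* Indexation: `n + 1` summands `p₀ … pₙ` (resp. `n + 1` products), so the printed `n` is our
  `n + 1`: printed `γₙ₋₁ ↦ γₙ`, `γ₂ₙ₋₂ ↦ γ₂ₙ`, `γ₂ₙ ↦ γ₂ₙ₊₂`, `γ₄ₙ₋₂ ↦ γ₄ₙ₊₂`. LEMMA 7.3's
  hypothesis `8(n-1)u ≤ 1` (`v = 2u`) is exactly our `4 n v ≤ 1`, and the hypotheses `8nu ≤ 1`
  of PROPOSITION 7.4 / COROLLARY 7.5 and `4nu ≤ 1` of PROPOSITION 7.1 / COROLLARY 7.2 (which read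
  `4 (n+1) v ≤ 1` here) imply it, so the `SumK` theorems below assume only `4 n v ≤ 1`;
  `16nu ≤ 1` (PROPOSITION 8.3 / COROLLARY 8.4) and `8nu ≤ 1` (PROPOSITION 8.1 / COROLLARY 8.2)
  are exactly our `8 (n+1) v ≤ 1`. The number of passes is a free parameter: `SumK` with
  `K = m + 2` makes `m + 1` passes (the printed exponent `K` is our `m + 2`; the source states
  PROPOSITIONS 7.1 / 7.4 for `K ≥ 3`, the statements here hold for every `K = m + 2 ≥ 2`), and
  `DotK` with `K = m + 3 ≥ 3` runs `SumK` with `K - 1 = m + 2` on the `2n + 2` residuals (printed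
  exponent `K` = our `m + 3`).
* The final recursive summation (Algorithm 12, line 6) of the last vector `c₀ … c_N` is typed, as
  in PROPOSITION 4.10 of `CompensatedSumDot.lean`, by an accumulator `σ₀ = 0`,
  `|σᵢ₊₁ - (σᵢ + cᵢ)| ≤ v |σᵢ + cᵢ|` (`i < N`) and `|res - (c_N + σ_N)| ≤ v |c_N + σ_N|`; for the
  literal left-to-right recursive sum `a₀ = c₀`, `aᵢ₊₁ = fl(aᵢ + cᵢ₊₁)`, `res = a_N`, take
  `σᵢ₊₁ = aᵢ` (the model's first step `σ₁ = fl(0 + c₀) = c₀` is then exact) —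
  `abs_sumK_recSum_sub_sum_le` does exactly this, and `abs_sumK_sub_sum_le_of_rd` is the fully
  literal instance with a rounding map `rd`.

Typed and PROVED:

* constants — `gamma_mono` (`γₘ ≤ γₘ'`, REMARK 1), `two_mul_gamma_le_gamma_two_mul`
  (`2γₘ ≤ γ₂ₘ`, used in the proofs of LEMMA 7.3 and PROPOSITION 8.3), `gamma_le_one`.
* ONE PASS (Algorithm 12 lines 2–4 = Algorithm 5 lines 2–4) — `IsVecSumPass` and, for it,
  eq. (4.10)/(7.37) `IsVecSumPass.sum_eq` (the pass preserves the sum), LEMMA 4.9 = eq. (7.40)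
  `IsVecSumPass.sum_abs_le` (sharp, `2((1 + v)ⁿ - 1)`) and `IsVecSumPass.sum_abs_le_gamma`
  (`Σ|p'ᵢ| ≤ |s| + 2γₙ(v) S`).
* LEMMA 7.3 — eq. (7.37) `sumK_passes_sum_eq`, eq. (7.39) `sumK_passes_sum_abs_le`
  (`S⁽ᵐ⁾ ≤ 3|s| + γ₂ₙ(v)ᵐ S`; the intermediate `(2γₙ(v))ᵐ` form is
  `sumK_passes_sum_abs_le_two_mul_gamma_pow`), eq. (7.38) `abs_sumK_res_sub_sum_le_sq`
  (`|res - s| ≤ v|s| + γₙ(v)² S⁽ᵐ⁾`, = PROPOSITION 4.10 on the last pass).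
* PROPOSITION 7.4 (`v = 2u`) / PROPOSITION 7.1 ([20], `v = u`) — `abs_sumK_sub_sum_le`:
  `|res - s| ≤ (v + 3γₙ(v)²)|s| + γ₂ₙ(v)^(m+2) S`; the same for the literal recursive final sum,
  `abs_sumK_recSum_sub_sum_le`, and LITERALLY for `sumK rd n p m` (every operation rounded by a
  map `rd` with `|rd t - t| ≤ v|t|`, transformations exact) — `abs_sumK_sub_sum_le_of_rd`;
  COROLLARY 7.5 / 7.2 — `abs_sumK_sub_sum_div_le`, `abs_sumK_sub_sum_div_le_of_rd`.
* §8, front end of `DotK` (Algorithm 14 lines 2–6) — eq. (8.42)/(8.43) `dotK_sum_residuals_eq`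
  (the `2n + 2` residuals sum to `xᵀy`), eqs. (8.44)–(8.49) `dotK_sum_abs_residuals_le` (sharp)
  and `dotK_sum_abs_residuals_le_gamma` (`Σ|rᵢ| ≤ |xᵀy| + γ₂ₙ₊₂(v) |x|ᵀ|y|`).
* PROPOSITION 8.3 (`v = 2u`) / PROPOSITION 8.1 ([20], `v = u`) — `abs_dotK_sub_dot_le`:
  `|res - xᵀy| ≤ (v + 2γ₄ₙ₊₂(v)²)|xᵀy| + γ₄ₙ₊₂(v)^(m+3) |x|ᵀ|y|`; COROLLARY 8.4 / 8.2 —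
  `abs_dotK_sub_dot_div_le`.

NOT formalised here: §3 (DSA / CADNA), the format-level proofs of the exactness of `PriestTwoSum`
(§4.3) and `TwoProdFMA` (§5.2) and of eq. (2.2) (hypotheses here), the operation counts, a literal
`rd`-instance of `DotK` (its front end is `CompensatedSumDot.lean`'s literal `compDotRd` with an
exact product transformation; the trace theorem covers it), §9 (experiments).
-/

namespace Literature.ComputerArithmetic.GraillatJezequelPicot2018

open Finset Literature.ComputerArithmetic.Higham2002
open Literature.ComputerArithmetic.GraillatJezequel2020

variable {K : Type*} [Field K] [LinearOrder K] [IsStrictOrderedRing K]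

/-! ## Constants: `γₘ ≤ γₘ'`, `2γₘ ≤ γ₂ₘ`, `γₘ ≤ 1` -/

/-- §2 REMARK 1, second relation (`γₘ(v) ≤ γₘ₊₁(v)`) iterated: `γₘ(v) ≤ γₘ'(v)` for `m ≤ m'`
and `m' v < 1`. [cite: GraillatJezequelPicot2018, §2 Remark 1] -/
theorem gamma_mono {v : K} (hv : 0 ≤ v) {m m' : ℕ} (hmm : m ≤ m') (hm' : (m' : K) * v < 1) :
    gamma v m ≤ gamma v m' := by
  have hcast : (m : K) ≤ (m' : K) := Nat.cast_le.mpr hmm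
  have hmv : (m : K) * v ≤ (m' : K) * v := mul_le_mul_of_nonneg_right hcast hv
  have h0 : 0 ≤ (m : K) * v := mul_nonneg (Nat.cast_nonneg m) hv
  have hm : (m : K) * v < 1 := lt_of_le_of_lt hmv hm'
  unfold gamma
  rw [div_le_div_iff₀ (by linarith) (by linarith)]
  nlinarith [hmv]

/-- "Because `2γₙ₋₁(2u) ≤ γ₂ₙ₋₂(2u)`" (proof of LEMMA 7.3, from (7.40) to (7.39)) and the last
two displays of the proof of PROPOSITION 8.3 (`2γₙ ≤ γ₂ₙ`, `3γ²₂ₙ₋₁ ≤ ¾γ²₄ₙ₋₂`): `2γₘ(v) ≤ γ₂ₘ(v)`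
for `2 m v < 1`. [cite: GraillatJezequelPicot2018, §7.2 proof of Lemma 7.3; §8.2 proof of
Proposition 8.3, (8.49)] -/
theorem two_mul_gamma_le_gamma_two_mul {v : K} (hv : 0 ≤ v) {m : ℕ}
    (hm : ((2 * m : ℕ) : K) * v < 1) : 2 * gamma v m ≤ gamma v (2 * m) := by
  have h0 : 0 ≤ (m : K) * v := mul_nonneg (Nat.cast_nonneg m) hv
  have hm2 : 2 * ((m : K) * v) < 1 := by push_cast at hm; linarith
  have hm1 : (m : K) * v < 1 := by linarith
  unfold gamma
  push_cast
  rw [mul_div_assoc', div_le_div_iff₀ (by linarith) (by linarith)]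
  nlinarith [mul_nonneg h0 h0]

/-- "`γ₄ₙ₋₂(2u) ≤ 1`" under `16nu ≤ 1` (end of the proof of PROPOSITION 8.3): `γₘ(v) ≤ 1` when
`2 m v ≤ 1`. [cite: GraillatJezequelPicot2018, §8.2 proof of Proposition 8.3] -/
theorem gamma_le_one {v : K} (hv : 0 ≤ v) {m : ℕ} (hm : 2 * ((m : K) * v) ≤ 1) :
    gamma v m ≤ 1 := by
  have h0 : 0 ≤ (m : K) * v := mul_nonneg (Nat.cast_nonneg m) hv
  unfold gamma
  rw [div_le_one (by linarith)]
  linarith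

/-! ## One pass of the error-free vector transformation (Algorithm 12, lines 2–4) -/

omit [IsStrictOrderedRing K] in
/-- ONE PASS of the loop of Algorithm 12 (`SumK`, lines 2–4 for one value of `k`; equally
Algorithm 5 `PriestCompSum`, lines 2–4) in MODEL form, on `p₀ … pₙ`: the running sums `π₀ = p₀`,
`|πᵢ₊₁ - (πᵢ + pᵢ₊₁)| ≤ v |πᵢ + pᵢ₊₁|` for `i < n` (one rounded addition each, eq. (2.2)), and
the new vector `p'`, made of the EXACT addition errors `p'ᵢ = πᵢ + pᵢ₊₁ - πᵢ₊₁` for `i < n`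
(`PriestTwoSum`, Algorithm 4, is an error-free transformation of the sum under any rounding mode,
§4.3) and of the last running sum, `p'ₙ = πₙ`. Entries of index `> n` are unconstrained.
[cite: GraillatJezequelPicot2018, §7.1 Algorithm 12 lines 2–4; §4.3 Algorithms 4–5]
[cite: OgitaRumpOishi2005] -/
def IsVecSumPass (v : K) (n : ℕ) (p π p' : ℕ → K) : Prop :=
  π 0 = p 0 ∧ (∀ i < n, |π (i + 1) - (π i + p (i + 1))| ≤ v * |π i + p (i + 1)|) ∧
    (∀ i < n, p' i = π i + p (i + 1) - π (i + 1)) ∧ p' n = π n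

namespace IsVecSumPass

variable {v : K} {n : ℕ} {p π p' : ℕ → K}

omit [IsStrictOrderedRing K] in
/-- eq. (4.10) (`s = Σ_{i<n} qᵢ + πₙ`, proof of PROPOSITION 4.10) = eq. (7.37) for one pass: the
pass preserves the sum, `Σ_{i≤n} p'ᵢ = Σ_{i≤n} pᵢ`.
[cite: GraillatJezequelPicot2018, §4.3 proof of Proposition 4.10, (4.10); §7.2 Lemma 7.3 (7.37)] -/
theorem sum_eq (h : IsVecSumPass v n p π p') :
    ∑ i ∈ range (n + 1), p' i = ∑ i ∈ range (n + 1), p i := by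
  obtain ⟨h0, -, hlow, hhigh⟩ := h
  have e1 : ∑ i ∈ range n, p' i = ∑ i ∈ range n, (π i + p (i + 1) - π (i + 1)) :=
    Finset.sum_congr rfl fun i hi => hlow i (Finset.mem_range.mp hi)
  rw [Finset.sum_range_succ p' n, hhigh, e1, sum_eq_acc_add_sum_err p π h0 n, add_comm]

/-- LEMMA 4.9 in sharp form (the proof's (4.7) `|πₙ| ≤ |s| + Σ|qᵢ|` and LEMMA 4.6's sharp
`Σ|qᵢ| ≤ ((1 + v)ⁿ - 1) S`): `Σ_{i≤n} |p'ᵢ| ≤ |s| + 2((1 + v)ⁿ - 1) S`, `s = Σ pᵢ`, `S = Σ |pᵢ|`.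
[cite: GraillatJezequelPicot2018, §4.3 Lemma 4.9, proof (4.7)–(4.8)] -/
theorem sum_abs_le (hv : 0 ≤ v) (h : IsVecSumPass v n p π p') :
    ∑ i ∈ range (n + 1), |p' i|
      ≤ |∑ i ∈ range (n + 1), p i| + 2 * ((1 + v) ^ n - 1) * ∑ i ∈ range (n + 1), |p i| := by
  obtain ⟨h0, hπ, hlow, hhigh⟩ := h
  have hE := sum_abs_err_le hv p π h0 n hπ
  have hid := sum_eq_acc_add_sum_err p π h0 n
  set s := ∑ i ∈ range (n + 1), p i with hs
  set E := ∑ i ∈ range n, |π i + p (i + 1) - π (i + 1)| with hEdef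
  have e1 : ∑ i ∈ range n, |p' i| = E :=
    Finset.sum_congr rfl fun i hi => by rw [hlow i (Finset.mem_range.mp hi)]
  -- eq. (4.7): `|πₙ| = |s - Σ qᵢ| ≤ |s| + Σ |qᵢ|`
  have hπn : |π n| ≤ |s| + E := by
    have e : π n = s - ∑ i ∈ range n, (π i + p (i + 1) - π (i + 1)) := by rw [hid]; ring
    rw [e]
    exact le_trans (abs_sub _ _) (add_le_add le_rfl (Finset.abs_sum_le_sum_abs _ _))
  rw [Finset.sum_range_succ (fun i => |p' i|) n, e1, hhigh]
  -- eq. (4.8), sharp: `E ≤ ((1 + v)ⁿ - 1) S`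
  linarith [hπn, hE]

/-- LEMMA 4.9 as printed, eq. (4.6) (= eq. (7.40) in the proof of LEMMA 7.3, with `v = 2u`): for
`n v < 1`, `Σ_{i<n} |qᵢ| + |πₙ| = Σ_{i≤n} |p'ᵢ| ≤ |s| + 2γₙ(v) S` (printed `2γₙ₋₁(2u)` for `n`
summands). [cite: GraillatJezequelPicot2018, §4.3 Lemma 4.9 (4.6); §7.2 (7.40)] -/
theorem sum_abs_le_gamma (hv : 0 ≤ v) (hn : (n : K) * v < 1) (h : IsVecSumPass v n p π p') :
    ∑ i ∈ range (n + 1), |p' i|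
      ≤ |∑ i ∈ range (n + 1), p i| + 2 * gamma v n * ∑ i ∈ range (n + 1), |p i| := by
  have h1 := h.sum_abs_le hv
  have hg := one_add_pow_sub_one_le_gamma hv hn
  have hS0 : (0 : K) ≤ ∑ i ∈ range (n + 1), |p i| := Finset.sum_nonneg fun _ _ => abs_nonneg _
  linarith [mul_le_mul_of_nonneg_right hg hS0]

end IsVecSumPass

/-! ## LEMMA 7.3: `m` passes (Algorithm 12, lines 1–5) -/

omit [IsStrictOrderedRing K] in
/-- LEMMA 7.3, eq. (7.37): the passes `P 0 ↦ P 1 ↦ … ↦ P m` (each an `IsVecSumPass` with running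
sums `Acc k`) preserve the sum: `Σᵢ pᵢ⁽ᵐ⁾ = Σᵢ pᵢ⁽⁰⁾ = s`.
[cite: GraillatJezequelPicot2018, §7.2 Lemma 7.3 (7.37)] [cite: OgitaRumpOishi2005] -/
theorem sumK_passes_sum_eq {v : K} {n : ℕ} (P Acc : ℕ → ℕ → K) :
    ∀ m : ℕ, (∀ k < m, IsVecSumPass v n (P k) (Acc k) (P (k + 1))) →
      ∑ i ∈ range (n + 1), P m i = ∑ i ∈ range (n + 1), P 0 i
  | 0, _ => rfl
  | m + 1, h => by
      rw [(h m (Nat.lt_succ_self m)).sum_eq]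
      exact sumK_passes_sum_eq P Acc m fun k hk => h k (Nat.lt_succ_of_lt hk)

/-- LEMMA 7.3, eq. (7.39) in the form its proof reaches first ("applying (7.40) to `p⁽ᵏ⁾` and
using (7.37) and `8(n-1)u ≤ 1`"): with `4 n v ≤ 1` (so `2γₙ(v) ≤ 2/3`), after `m` passes
`S⁽ᵐ⁾ = Σᵢ |pᵢ⁽ᵐ⁾| ≤ 3|s| + (2γₙ(v))ᵐ S⁽⁰⁾` (induction: `S⁽ᵏ⁺¹⁾ ≤ |s| + 2γₙ S⁽ᵏ⁾` by (7.40) and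
`(1 + 3·2γₙ)|s| ≤ 3|s|`). [cite: GraillatJezequelPicot2018, §7.2 proof of Lemma 7.3, (7.39)–(7.40)]
[cite: OgitaRumpOishi2005] -/
theorem sumK_passes_sum_abs_le_two_mul_gamma_pow {v : K} (hv : 0 ≤ v) {n : ℕ}
    (hn4 : 4 * ((n : K) * v) ≤ 1) (P Acc : ℕ → ℕ → K) :
    ∀ m : ℕ, (∀ k < m, IsVecSumPass v n (P k) (Acc k) (P (k + 1))) →
      ∑ i ∈ range (n + 1), |P m i|
        ≤ 3 * |∑ i ∈ range (n + 1), P 0 i|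
          + (2 * gamma v n) ^ m * ∑ i ∈ range (n + 1), |P 0 i|
  | 0, _ => by
      simp only [pow_zero, one_mul]
      linarith [abs_nonneg (∑ i ∈ range (n + 1), P 0 i)]
  | m + 1, h => by
      have h0 : 0 ≤ (n : K) * v := mul_nonneg (Nat.cast_nonneg n) hv
      have hn : (n : K) * v < 1 := by linarith
      have ih := sumK_passes_sum_abs_le_two_mul_gamma_pow hv hn4 P Acc m
        fun k hk => h k (Nat.lt_succ_of_lt hk)
      have hstep := (h m (Nat.lt_succ_self m)).sum_abs_le_gamma hv hn
      have hsum : ∑ i ∈ range (n + 1), P m i = ∑ i ∈ range (n + 1), P 0 i :=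
        sumK_passes_sum_eq P Acc m fun k hk => h k (Nat.lt_succ_of_lt hk)
      rw [hsum] at hstep
      -- `a = 2γₙ(v) ≤ 2/3` from `4 n v ≤ 1`
      have hγ : gamma v n ≤ 1 / 3 := by
        unfold gamma
        rw [div_le_iff₀ (by linarith)]
        linarith
      have ha0 : 0 ≤ 2 * gamma v n := mul_nonneg (by norm_num) (gamma_nonneg hv hn)
      have ha23 : 3 * (2 * gamma v n) ≤ 2 := by linarith
      have h1 := mul_le_mul_of_nonneg_left ih ha0
      have h2 := mul_le_mul_of_nonneg_right ha23 (abs_nonneg (∑ i ∈ range (n + 1), P 0 i))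
      rw [pow_succ]
      linarith [hstep, h1, h2]

/-- LEMMA 7.3, eq. (7.39) as printed: with `4 n v ≤ 1` (printed `8(n-1)u ≤ 1`, `v = 2u`), after
`m` passes `S⁽ᵐ⁾ ≤ 3|s| + γ₂ₙ(v)ᵐ S⁽⁰⁾` (printed `γᵏ₂ₙ₋₂(2u)` for `n` summands; from the previous
lemma and `2γₙ ≤ γ₂ₙ`).
[cite: GraillatJezequelPicot2018, §7.2 Lemma 7.3 (7.39)] [cite: OgitaRumpOishi2005] -/
theorem sumK_passes_sum_abs_le {v : K} (hv : 0 ≤ v) {n : ℕ} (hn4 : 4 * ((n : K) * v) ≤ 1)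
    (P Acc : ℕ → ℕ → K) (m : ℕ) (h : ∀ k < m, IsVecSumPass v n (P k) (Acc k) (P (k + 1))) :
    ∑ i ∈ range (n + 1), |P m i|
      ≤ 3 * |∑ i ∈ range (n + 1), P 0 i|
        + gamma v (2 * n) ^ m * ∑ i ∈ range (n + 1), |P 0 i| := by
  have h1 := sumK_passes_sum_abs_le_two_mul_gamma_pow hv hn4 P Acc m h
  have h0 : 0 ≤ (n : K) * v := mul_nonneg (Nat.cast_nonneg n) hv
  have hn : (n : K) * v < 1 := by linarith
  have h2n : ((2 * n : ℕ) : K) * v < 1 := by push_cast; linarith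
  have hle : 2 * gamma v n ≤ gamma v (2 * n) := two_mul_gamma_le_gamma_two_mul hv h2n
  have ha0 : 0 ≤ 2 * gamma v n := mul_nonneg (by norm_num) (gamma_nonneg hv hn)
  have hpow : (2 * gamma v n) ^ m ≤ gamma v (2 * n) ^ m := pow_le_pow_left₀ ha0 hle m
  have hS0 : (0 : K) ≤ ∑ i ∈ range (n + 1), |P 0 i| :=
    Finset.sum_nonneg fun _ _ => abs_nonneg _
  linarith [mul_le_mul_of_nonneg_right hpow hS0]

/-! ## LEMMA 7.3 (7.38), PROPOSITION 7.4 / 7.1, COROLLARY 7.5 / 7.2 -/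

/-- LEMMA 7.3, eq. (7.38): the last pass `P m ↦ P (m+1)` (running sums `Acc m`) followed by the
recursive summation of `P (m+1)` (accumulator `σ₀ = 0`, `|σᵢ₊₁ - (σᵢ + pᵢ⁽ᵐ⁺¹⁾)| ≤ v|…|` for
`i < n`, then `|res - (pₙ⁽ᵐ⁺¹⁾ + σₙ)| ≤ v|…|`, where `pₙ⁽ᵐ⁺¹⁾ = Acc m n`) IS `PriestCompSum`
(Algorithm 5) applied to `p⁽ᵐ⁾`, so PROPOSITION 4.10 (4.9) gives, for `n v < 1`,
`|res - s| ≤ v|s| + γₙ(v)² S⁽ᵐ⁾` (the sum `s` being that of `p⁽⁰⁾` by (7.37)).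
[cite: GraillatJezequelPicot2018, §7.2 Lemma 7.3 (7.38); §4.3 Proposition 4.10 (4.9)]
[cite: OgitaRumpOishi2005] -/
theorem abs_sumK_res_sub_sum_le_sq {v : K} (hv : 0 ≤ v) {n : ℕ} (hn : (n : K) * v < 1)
    (P Acc : ℕ → ℕ → K) (m : ℕ) (hpass : ∀ k < m + 1, IsVecSumPass v n (P k) (Acc k) (P (k + 1)))
    (σ : ℕ → K) (res : K) (hσ0 : σ 0 = 0)
    (hσ : ∀ i < n, |σ (i + 1) - (σ i + P (m + 1) i)| ≤ v * |σ i + P (m + 1) i|)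
    (hres : |res - (P (m + 1) n + σ n)| ≤ v * |P (m + 1) n + σ n|) :
    |res - ∑ i ∈ range (n + 1), P 0 i|
      ≤ v * |∑ i ∈ range (n + 1), P 0 i| + gamma v n ^ 2 * ∑ i ∈ range (n + 1), |P m i| := by
  obtain ⟨h0, hπ, hlow, hhigh⟩ := hpass m (Nat.lt_succ_self m)
  have hsum : ∑ i ∈ range (n + 1), P m i = ∑ i ∈ range (n + 1), P 0 i :=
    sumK_passes_sum_eq P Acc m fun k hk => hpass k (Nat.lt_succ_of_lt hk)
  rw [hhigh] at hres
  have h := abs_compSum_sub_sum_le_gamma_sq hv hn (P m) (Acc m) (P (m + 1)) σ res h0 hπ hlow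
    hσ0 hσ hres
  rwa [hsum] at h

/-- PROPOSITION 7.4 (directed rounding, `v = 2u`) and — same statement, same proof, with `v = u` —
PROPOSITION 7.1 as recalled from [20]: MODEL form of Algorithm 12 (`SumK`) on `p₀ … pₙ = P 0` with
`K = m + 2 ≥ 2`, i.e. `K - 1 = m + 1` exact vector transformations `P k ↦ P (k+1)`
(`IsVecSumPass`, running sums `Acc k`) followed by the recursive summation of `P (m+1)` (line 6;
accumulator `σ`, result `res`, as in `abs_sumK_res_sub_sum_le_sq`). With `4 n v ≤ 1` (implied
by the printed `8nu ≤ 1`, resp. `4nu ≤ 1`, for `n` summands, which read `4 (n+1) v ≤ 1` here):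
`|res - s| ≤ (v + 3γₙ(v)²)|s| + γ₂ₙ(v)^(m+2) S` — printed `(2u + 3γ²ₙ₋₁(2u))|s| + γᴷ₂ₙ₋₂(2u) S`,
resp. `(u + 3γ²ₙ₋₁(u))|s| + γᴷ₂ₙ₋₂(u) S`, stated there for `K ≥ 3` and valid here for every
`K = m + 2 ≥ 2`. Proof as printed: (7.38), then (7.39) with `γₙ² ≤ γ₂ₙ²`.
[cite: GraillatJezequelPicot2018, §7.2 Proposition 7.4; §7.1 Proposition 7.1]
[cite: OgitaRumpOishi2005] -/
theorem abs_sumK_sub_sum_le {v : K} (hv : 0 ≤ v) {n : ℕ} (hn4 : 4 * ((n : K) * v) ≤ 1)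
    (P Acc : ℕ → ℕ → K) (m : ℕ) (hpass : ∀ k < m + 1, IsVecSumPass v n (P k) (Acc k) (P (k + 1)))
    (σ : ℕ → K) (res : K) (hσ0 : σ 0 = 0)
    (hσ : ∀ i < n, |σ (i + 1) - (σ i + P (m + 1) i)| ≤ v * |σ i + P (m + 1) i|)
    (hres : |res - (P (m + 1) n + σ n)| ≤ v * |P (m + 1) n + σ n|) :
    |res - ∑ i ∈ range (n + 1), P 0 i|
      ≤ (v + 3 * gamma v n ^ 2) * |∑ i ∈ range (n + 1), P 0 i|
        + gamma v (2 * n) ^ (m + 2) * ∑ i ∈ range (n + 1), |P 0 i| := by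
  have h0 : 0 ≤ (n : K) * v := mul_nonneg (Nat.cast_nonneg n) hv
  have hn : (n : K) * v < 1 := by linarith
  have h2n : ((2 * n : ℕ) : K) * v < 1 := by push_cast; linarith
  have h738 := abs_sumK_res_sub_sum_le_sq hv hn P Acc m hpass σ res hσ0 hσ hres
  have h739 := sumK_passes_sum_abs_le hv hn4 P Acc m fun k hk => hpass k (Nat.lt_succ_of_lt hk)
  have hγ0 : 0 ≤ gamma v n := gamma_nonneg hv hn
  have hΓ0 : 0 ≤ gamma v (2 * n) := gamma_nonneg hv h2n
  have hS0 : (0 : K) ≤ ∑ i ∈ range (n + 1), |P 0 i| :=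
    Finset.sum_nonneg fun _ _ => abs_nonneg _
  -- `γₙ ≤ γ₂ₙ`, hence `γₙ² γ₂ₙᵐ ≤ γ₂ₙᵐ⁺²`
  have hγΓ : gamma v n ≤ gamma v (2 * n) := gamma_mono hv (by omega) h2n
  have h1 : gamma v n ^ 2 * ∑ i ∈ range (n + 1), |P m i|
      ≤ gamma v n ^ 2 * (3 * |∑ i ∈ range (n + 1), P 0 i|
          + gamma v (2 * n) ^ m * ∑ i ∈ range (n + 1), |P 0 i|) :=
    mul_le_mul_of_nonneg_left h739 (sq_nonneg _)
  have h2 : gamma v n ^ 2 * gamma v (2 * n) ^ m ≤ gamma v (2 * n) ^ (m + 2) := by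
    rw [pow_add, mul_comm (gamma v n ^ 2)]
    exact mul_le_mul_of_nonneg_left (pow_le_pow_left₀ hγ0 hγΓ 2) (pow_nonneg hΓ0 m)
  have h3 := mul_le_mul_of_nonneg_right h2 hS0
  linarith [h738, h1, h3]

/-- PROPOSITION 7.4 / 7.1 with the final recursive summation (Algorithm 12, line 6) written
literally as a left-to-right accumulation of the last vector: `a₀ = p₀⁽ᵐ⁺¹⁾`,
`|aᵢ₊₁ - (aᵢ + pᵢ₊₁⁽ᵐ⁺¹⁾)| ≤ v |aᵢ + pᵢ₊₁⁽ᵐ⁺¹⁾|` for `i < n`, `res = aₙ` (the accumulator form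
with `σᵢ₊₁ = aᵢ`). With `4 n v ≤ 1`: `|aₙ - s| ≤ (v + 3γₙ(v)²)|s| + γ₂ₙ(v)^(m+2) S`.
[cite: GraillatJezequelPicot2018, §7.2 Proposition 7.4; §7.1 Algorithm 12 line 6,
Proposition 7.1] [cite: OgitaRumpOishi2005] -/
theorem abs_sumK_recSum_sub_sum_le {v : K} (hv : 0 ≤ v) {n : ℕ} (hn4 : 4 * ((n : K) * v) ≤ 1)
    (P Acc : ℕ → ℕ → K) (m : ℕ) (hpass : ∀ k < m + 1, IsVecSumPass v n (P k) (Acc k) (P (k + 1)))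
    (a : ℕ → K) (ha0 : a 0 = P (m + 1) 0)
    (ha : ∀ i < n, |a (i + 1) - (a i + P (m + 1) (i + 1))| ≤ v * |a i + P (m + 1) (i + 1)|) :
    |a n - ∑ i ∈ range (n + 1), P 0 i|
      ≤ (v + 3 * gamma v n ^ 2) * |∑ i ∈ range (n + 1), P 0 i|
        + gamma v (2 * n) ^ (m + 2) * ∑ i ∈ range (n + 1), |P 0 i| := by
  -- the accumulator of `PriestCompSum`'s lines 5 and 7: `σ₀ = 0`, `σᵢ₊₁ = aᵢ`
  let σ : ℕ → K := fun i => match i with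
    | 0 => 0
    | j + 1 => a j
  have hσ0 : σ 0 = 0 := rfl
  have hσ : ∀ i < n, |σ (i + 1) - (σ i + P (m + 1) i)| ≤ v * |σ i + P (m + 1) i| := by
    intro i hi
    cases i with
    | zero =>
        show |a 0 - (0 + P (m + 1) 0)| ≤ v * |0 + P (m + 1) 0|
        rw [ha0, zero_add, sub_self, abs_zero]
        exact mul_nonneg hv (abs_nonneg _)
    | succ j =>
        show |a (j + 1) - (a j + P (m + 1) (j + 1))| ≤ v * |a j + P (m + 1) (j + 1)|
        exact ha j (Nat.lt_of_succ_lt hi)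
  have hres : |a n - (P (m + 1) n + σ n)| ≤ v * |P (m + 1) n + σ n| := by
    cases n with
    | zero =>
        show |a 0 - (P (m + 1) 0 + 0)| ≤ v * |P (m + 1) 0 + 0|
        rw [ha0, add_zero, sub_self, abs_zero]
        exact mul_nonneg hv (abs_nonneg _)
    | succ j =>
        show |a (j + 1) - (P (m + 1) (j + 1) + a j)| ≤ v * |P (m + 1) (j + 1) + a j|
        rw [add_comm (P (m + 1) (j + 1))]
        exact ha j (Nat.lt_succ_self j)
  exact abs_sumK_sub_sum_le hv hn4 P Acc m hpass σ (a n) hσ0 hσ hres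

/-- COROLLARY 7.5 (`v = 2u`) / COROLLARY 7.2 ([20], `v = u`): the relative form of
PROPOSITION 7.4 / 7.1, `|res - s| / |s| ≤ v + 3γₙ(v)² + γ₂ₙ(v)^(m+2) cond(Σ pᵢ)` with
`cond(Σ pᵢ) = S / |s|` (junk value `x / 0 = 0` when `s = 0`).
[cite: GraillatJezequelPicot2018, §7.2 Corollary 7.5; §7.1 Corollary 7.2]
[cite: OgitaRumpOishi2005] -/
theorem abs_sumK_sub_sum_div_le {v : K} (hv : 0 ≤ v) {n : ℕ} (hn4 : 4 * ((n : K) * v) ≤ 1)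
    (P Acc : ℕ → ℕ → K) (m : ℕ) (hpass : ∀ k < m + 1, IsVecSumPass v n (P k) (Acc k) (P (k + 1)))
    (σ : ℕ → K) (res : K) (hσ0 : σ 0 = 0)
    (hσ : ∀ i < n, |σ (i + 1) - (σ i + P (m + 1) i)| ≤ v * |σ i + P (m + 1) i|)
    (hres : |res - (P (m + 1) n + σ n)| ≤ v * |P (m + 1) n + σ n|) :
    |res - ∑ i ∈ range (n + 1), P 0 i| / |∑ i ∈ range (n + 1), P 0 i|
      ≤ v + 3 * gamma v n ^ 2
        + gamma v (2 * n) ^ (m + 2)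
          * ((∑ i ∈ range (n + 1), |P 0 i|) / |∑ i ∈ range (n + 1), P 0 i|) := by
  have h := abs_sumK_sub_sum_le hv hn4 P Acc m hpass σ res hσ0 hσ hres
  set s := ∑ i ∈ range (n + 1), P 0 i
  set S := ∑ i ∈ range (n + 1), |P 0 i|
  rcases eq_or_lt_of_le (abs_nonneg s) with hs | hs
  · rw [← hs]
    simp only [div_zero, mul_zero, add_zero]
    linarith [sq_nonneg (gamma v n)]
  · rw [div_le_iff₀ hs]
    have h3 : gamma v (2 * n) ^ (m + 2) * (S / |s|) * |s| = gamma v (2 * n) ^ (m + 2) * S := by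
      rw [mul_assoc, div_mul_cancel₀ _ (ne_of_gt hs)]
    linarith [h, h3]

/-! ## Algorithm 12 literally, every operation rounded by a map `rd` -/

/-- Algorithm 12, ONE pass (lines 2–4) on `p₀ … pₙ` with every addition rounded by `rd` and the
transformation exact (`PriestTwoSum`): the new vector is `(e₀, …, eₙ₋₁, πₙ, …)` with
`π = GraillatJezequel2020.sumRd rd p` the rounded running sums and
`eᵢ = GraillatJezequel2020.fcsErr rd p i = πᵢ + pᵢ₊₁ - πᵢ₊₁` the exact addition errors; entries of
index `≥ n` are set to `πₙ` (only index `n` matters).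
[cite: GraillatJezequelPicot2018, §7.1 Algorithm 12 lines 2–4; §4.3 Algorithms 4–5] -/
def vecSumRd (rd : K → K) (n : ℕ) (p : ℕ → K) : ℕ → K :=
  fun i => if i < n then fcsErr rd p i else sumRd rd p n

/-- Algorithm 12, lines 1–5: the vector after `k` passes, `p⁽⁰⁾ = p`, `p⁽ᵏ⁺¹⁾ = VecSum(p⁽ᵏ⁾)`.
[cite: GraillatJezequelPicot2018, §7.1 Algorithm 12 lines 1–5] -/
def sumKVec (rd : K → K) (n : ℕ) (p : ℕ → K) : ℕ → ℕ → K
  | 0 => p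
  | k + 1 => vecSumRd rd n (sumKVec rd n p k)

/-- Algorithm 12 (`SumK`) on `p₀ … pₙ` with `K = m + 2 ≥ 2`: `K - 1 = m + 1` passes, then line 6,
the rounded recursive summation (Algorithm 1 = `GraillatJezequel2020.sumRd`) of the last vector.
[cite: GraillatJezequelPicot2018, §7.1 Algorithm 12] [cite: OgitaRumpOishi2005] -/
def sumK (rd : K → K) (n : ℕ) (p : ℕ → K) (m : ℕ) : K :=
  sumRd rd (sumKVec rd n p (m + 1)) n

omit [IsStrictOrderedRing K] in
/-- Under `|rd t - t| ≤ v |t|` (eq. (2.2)) one literal pass `vecSumRd` is an `IsVecSumPass` with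
running sums `sumRd rd p`.
[cite: GraillatJezequelPicot2018, §7.1 Algorithm 12 lines 2–4; §2 (2.2)] -/
theorem isVecSumPass_vecSumRd {rd : K → K} {v : K} (hacc : ∀ t, |rd t - t| ≤ v * |t|)
    (n : ℕ) (p : ℕ → K) : IsVecSumPass v n p (sumRd rd p) (vecSumRd rd n p) := by
  refine ⟨rfl, fun i _ => hacc _, fun i hi => ?_, ?_⟩
  · simp [vecSumRd, hi, fcsErr]
  · simp [vecSumRd]

/-- PROPOSITION 7.4 (`v = 2u`) / PROPOSITION 7.1 ([20], `v = u`) LITERALLY for Algorithm 12: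
if every operation is rounded by a map `rd` with `|rd t - t| ≤ v |t|` (eq. (2.2)) and the
transformations are exact, then for `4 n v ≤ 1`
`|sumK rd n p m - s| ≤ (v + 3γₙ(v)²)|s| + γ₂ₙ(v)^(m+2) S` (`K = m + 2`).
[cite: GraillatJezequelPicot2018, §7.2 Proposition 7.4; §7.1 Proposition 7.1, Algorithm 12]
[cite: OgitaRumpOishi2005] -/
theorem abs_sumK_sub_sum_le_of_rd {rd : K → K} {v : K} (hv : 0 ≤ v) {n : ℕ}
    (hn4 : 4 * ((n : K) * v) ≤ 1) (hacc : ∀ t, |rd t - t| ≤ v * |t|) (p : ℕ → K) (m : ℕ) :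
    |sumK rd n p m - ∑ i ∈ range (n + 1), p i|
      ≤ (v + 3 * gamma v n ^ 2) * |∑ i ∈ range (n + 1), p i|
        + gamma v (2 * n) ^ (m + 2) * ∑ i ∈ range (n + 1), |p i| :=
  abs_sumK_recSum_sub_sum_le hv hn4 (sumKVec rd n p) (fun k => sumRd rd (sumKVec rd n p k)) m
    (fun k _ => isVecSumPass_vecSumRd hacc n (sumKVec rd n p k))
    (sumRd rd (sumKVec rd n p (m + 1))) rfl (fun _ _ => hacc _)

/-- COROLLARY 7.5 / 7.2 LITERALLY for Algorithm 12 under `|rd t - t| ≤ v |t|`, `4 n v ≤ 1`: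
`|sumK rd n p m - s| / |s| ≤ v + 3γₙ(v)² + γ₂ₙ(v)^(m+2) · S / |s|`.
[cite: GraillatJezequelPicot2018, §7.2 Corollary 7.5; §7.1 Corollary 7.2]
[cite: OgitaRumpOishi2005] -/
theorem abs_sumK_sub_sum_div_le_of_rd {rd : K → K} {v : K} (hv : 0 ≤ v) {n : ℕ}
    (hn4 : 4 * ((n : K) * v) ≤ 1) (hacc : ∀ t, |rd t - t| ≤ v * |t|) (p : ℕ → K) (m : ℕ) :
    |sumK rd n p m - ∑ i ∈ range (n + 1), p i| / |∑ i ∈ range (n + 1), p i|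
      ≤ v + 3 * gamma v n ^ 2
        + gamma v (2 * n) ^ (m + 2)
          * ((∑ i ∈ range (n + 1), |p i|) / |∑ i ∈ range (n + 1), p i|) := by
  have h := abs_sumK_sub_sum_le_of_rd hv hn4 hacc p m
  set s := ∑ i ∈ range (n + 1), p i
  set S := ∑ i ∈ range (n + 1), |p i|
  rcases eq_or_lt_of_le (abs_nonneg s) with hs | hs
  · rw [← hs]
    simp only [div_zero, mul_zero, add_zero]
    linarith [sq_nonneg (gamma v n)]
  · rw [div_le_iff₀ hs]
    have h3 : gamma v (2 * n) ^ (m + 2) * (S / |s|) * |s| = gamma v (2 * n) ^ (m + 2) * S := by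
      rw [mul_assoc, div_mul_cancel₀ _ (ne_of_gt hs)]
    linarith [h, h3]

/-! ## §8 `DotK`: the front end (Algorithm 14, lines 2–6) and PROPOSITION 8.3 / 8.1 -/

omit [LinearOrder K] [IsStrictOrderedRing K] in
/-- eq. (8.42) / (8.43): the front end of `DotK` (Algorithm 14, lines 2–6; `TwoProdFMA` exact, the
sum transformation exact) turns `x₀y₀ … xₙyₙ` into `2n + 2` residuals — the product residuals
`rᵢ = xᵢyᵢ - hᵢ` (`i ≤ n`), the addition errors `rₙ₊₁₊ᵢ = pᵢ + hᵢ₊₁ - pᵢ₊₁` (`i < n`) of the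
running sums `p₀ = h₀, p₁, …, pₙ` of the `hᵢ`, and `r₂ₙ₊₁ = pₙ` — whose sum is `xᵀy` exactly.
[cite: GraillatJezequelPicot2018, §8.2 proof of Proposition 8.3, (8.42)–(8.43); §8.1
Algorithms 13–14] [cite: OgitaRumpOishi2005] -/
theorem dotK_sum_residuals_eq (n : ℕ) (x y h p r : ℕ → K) (hp0 : p 0 = h 0)
    (hr₁ : ∀ i < n + 1, r i = x i * y i - h i)
    (hr₂ : ∀ i < n, r (n + 1 + i) = p i + h (i + 1) - p (i + 1)) (hr₃ : r (2 * n + 1) = p n) :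
    ∑ i ∈ range (2 * n + 2), r i = ∑ i ∈ range (n + 1), x i * y i := by
  have e0 : 2 * n + 2 = (n + 1 + n) + 1 := by ring
  have e1 : ∑ i ∈ range (n + 1), r i = ∑ i ∈ range (n + 1), (x i * y i - h i) :=
    Finset.sum_congr rfl fun i hi => hr₁ i (Finset.mem_range.mp hi)
  have e2 : ∑ i ∈ range n, r (n + 1 + i) = ∑ i ∈ range n, (p i + h (i + 1) - p (i + 1)) :=
    Finset.sum_congr rfl fun i hi => hr₂ i (Finset.mem_range.mp hi)
  have e3 : n + 1 + n = 2 * n + 1 := by ring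
  have hid := sum_eq_acc_add_sum_err h p hp0 n
  rw [e0, Finset.sum_range_succ, Finset.sum_range_add, e1, e2, e3, hr₃,
    Finset.sum_sub_distrib (f := fun i => x i * y i) (g := h)]
  linear_combination (-1 : K) * hid

/-- eqs. (8.44)–(8.47) in sharp form: with the products rounded, `|hᵢ - xᵢyᵢ| ≤ v |xᵢyᵢ|`
(`i ≤ n`), and the running sums of the `hᵢ` rounded, `p₀ = h₀`,
`|pᵢ₊₁ - (pᵢ + hᵢ₊₁)| ≤ v |pᵢ + hᵢ₊₁|` (`i < n`), the residuals of `dotK_sum_residuals_eq` have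
`Σ_{i<2n+2} |rᵢ| ≤ |xᵀy| + 2((1 + v)ⁿ⁺¹ - 1) |x|ᵀ|y|` ((8.44): `Σ_{i≤n}|rᵢ| ≤ v|x|ᵀ|y|`;
(8.46): LEMMA 4.6 on the `hᵢ` with `Σ|hᵢ| ≤ (1 + v)|x|ᵀ|y|`; (8.47): `|pₙ| ≤ |xᵀy| + Σ_{i≤2n}|rᵢ|`).
[cite: GraillatJezequelPicot2018, §8.2 proof of Proposition 8.3, (8.44)–(8.47)]
[cite: OgitaRumpOishi2005] -/
theorem dotK_sum_abs_residuals_le {v : K} (hv : 0 ≤ v) (n : ℕ) (x y h p r : ℕ → K)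
    (hh : ∀ i < n + 1, |h i - x i * y i| ≤ v * |x i * y i|) (hp0 : p 0 = h 0)
    (hp : ∀ i < n, |p (i + 1) - (p i + h (i + 1))| ≤ v * |p i + h (i + 1)|)
    (hr₁ : ∀ i < n + 1, r i = x i * y i - h i)
    (hr₂ : ∀ i < n, r (n + 1 + i) = p i + h (i + 1) - p (i + 1)) (hr₃ : r (2 * n + 1) = p n) :
    ∑ i ∈ range (2 * n + 2), |r i|
      ≤ |∑ i ∈ range (n + 1), x i * y i|
        + 2 * ((1 + v) ^ (n + 1) - 1) * ∑ i ∈ range (n + 1), |x i * y i| := by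
  have hid := dotK_sum_residuals_eq n x y h p r hp0 hr₁ hr₂ hr₃
  -- (8.44): the product residuals
  have hR : ∑ i ∈ range (n + 1), |r i| ≤ v * ∑ i ∈ range (n + 1), |x i * y i| := by
    rw [Finset.mul_sum]
    refine Finset.sum_le_sum fun i hi => ?_
    rw [hr₁ i (Finset.mem_range.mp hi), abs_sub_comm]
    exact hh i (Finset.mem_range.mp hi)
  -- `Σ |hᵢ| ≤ (1 + v) |x|ᵀ|y|`
  have hH : ∑ i ∈ range (n + 1), |h i| ≤ (1 + v) * ∑ i ∈ range (n + 1), |x i * y i| := by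
    rw [Finset.mul_sum]
    refine Finset.sum_le_sum fun i hi => ?_
    have h1 := hh i (Finset.mem_range.mp hi)
    have h2 : |h i| ≤ |h i - x i * y i| + |x i * y i| := by
      have := abs_add_le (h i - x i * y i) (x i * y i); rwa [sub_add_cancel] at this
    linarith
  -- (8.46): LEMMA 4.6 (sharp) on the running sums of the `hᵢ`
  have hE : ∑ i ∈ range n, |r (n + 1 + i)|
      ≤ ((1 + v) ^ n - 1) * ((1 + v) * ∑ i ∈ range (n + 1), |x i * y i|) := by
    have e2 : ∑ i ∈ range n, |r (n + 1 + i)| = ∑ i ∈ range n, |p i + h (i + 1) - p (i + 1)| :=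
      Finset.sum_congr rfl fun i hi => by rw [hr₂ i (Finset.mem_range.mp hi)]
    rw [e2]
    have hg0 : 0 ≤ (1 + v) ^ n - 1 := by
      have := one_le_pow₀ (M₀ := K) (a := 1 + v) (by linarith) (n := n); linarith
    exact le_trans (sum_abs_err_le hv h p hp0 n hp) (mul_le_mul_of_nonneg_left hH hg0)
  -- (8.47): the last residual `r₂ₙ₊₁ = pₙ = xᵀy - Σ_{i≤2n} rᵢ`
  have e0 : 2 * n + 2 = (2 * n + 1) + 1 := by ring
  have e4 : 2 * n + 1 = (n + 1) + n := by ring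
  have hlast : |r (2 * n + 1)|
      ≤ |∑ i ∈ range (n + 1), x i * y i| + ∑ i ∈ range (2 * n + 1), |r i| := by
    have e : r (2 * n + 1) = ∑ i ∈ range (n + 1), x i * y i - ∑ i ∈ range (2 * n + 1), r i := by
      rw [← hid, e0, Finset.sum_range_succ]; ring
    rw [e]
    exact le_trans (abs_sub _ _) (add_le_add le_rfl (Finset.abs_sum_le_sum_abs _ _))
  have hfirst : ∑ i ∈ range (2 * n + 1), |r i|
      ≤ ((1 + v) ^ (n + 1) - 1) * ∑ i ∈ range (n + 1), |x i * y i| := by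
    rw [e4, Finset.sum_range_add]
    have e5 : ((1 + v) ^ n - 1) * ((1 + v) * ∑ i ∈ range (n + 1), |x i * y i|)
        = ((1 + v) ^ (n + 1) - 1) * ∑ i ∈ range (n + 1), |x i * y i|
          - v * ∑ i ∈ range (n + 1), |x i * y i| := by ring
    linarith [hR, hE, e5]
  rw [e0, Finset.sum_range_succ]
  have hfirst' : ∑ i ∈ range (2 * n + 1), |r i|
      ≤ ((1 + v) ^ (n + 1) - 1) * ∑ i ∈ range (n + 1), |x i * y i| := hfirst
  linarith [hfirst', hlast]

/-- eqs. (8.48)–(8.49): with `(2n + 2) v < 1`, `Σ_{i<2n+2} |rᵢ| ≤ |xᵀy| + γ₂ₙ₊₂(v) |x|ᵀ|y|`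
(printed `γ₂ₙ(2u)` for `n` products; `2((1 + v)ⁿ⁺¹ - 1) ≤ 2γₙ₊₁(v) ≤ γ₂ₙ₊₂(v)`).
[cite: GraillatJezequelPicot2018, §8.2 proof of Proposition 8.3, (8.48)–(8.49)]
[cite: OgitaRumpOishi2005] -/
theorem dotK_sum_abs_residuals_le_gamma {v : K} (hv : 0 ≤ v) (n : ℕ)
    (hn2 : ((2 * n + 2 : ℕ) : K) * v < 1) (x y h p r : ℕ → K)
    (hh : ∀ i < n + 1, |h i - x i * y i| ≤ v * |x i * y i|) (hp0 : p 0 = h 0)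
    (hp : ∀ i < n, |p (i + 1) - (p i + h (i + 1))| ≤ v * |p i + h (i + 1)|)
    (hr₁ : ∀ i < n + 1, r i = x i * y i - h i)
    (hr₂ : ∀ i < n, r (n + 1 + i) = p i + h (i + 1) - p (i + 1)) (hr₃ : r (2 * n + 1) = p n) :
    ∑ i ∈ range (2 * n + 2), |r i|
      ≤ |∑ i ∈ range (n + 1), x i * y i|
        + gamma v (2 * n + 2) * ∑ i ∈ range (n + 1), |x i * y i| := by
  have h1 := dotK_sum_abs_residuals_le hv n x y h p r hh hp0 hp hr₁ hr₂ hr₃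
  have h0 : 0 ≤ ((n + 1 : ℕ) : K) * v := mul_nonneg (Nat.cast_nonneg _) hv
  have hn1 : ((n + 1 : ℕ) : K) * v < 1 := by push_cast at hn2 h0 ⊢; linarith
  have h2m : ((2 * (n + 1) : ℕ) : K) * v < 1 := by push_cast at hn2 ⊢; linarith
  have hg := one_add_pow_sub_one_le_gamma hv hn1
  have h2 := two_mul_gamma_le_gamma_two_mul hv h2m
  have e : 2 * (n + 1) = 2 * n + 2 := by ring
  rw [e] at h2
  have hT0 : (0 : K) ≤ ∑ i ∈ range (n + 1), |x i * y i| :=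
    Finset.sum_nonneg fun _ _ => abs_nonneg _
  have h3 : 2 * ((1 + v) ^ (n + 1) - 1) ≤ gamma v (2 * n + 2) := by linarith
  linarith [mul_le_mul_of_nonneg_right h3 hT0]

/-- PROPOSITION 8.3 (directed rounding, `v = 2u`, printed `16nu ≤ 1`) and — same statement, same
proof, with `v = u`, printed `8nu ≤ 1` — PROPOSITION 8.1 as recalled from [20]: MODEL form of
Algorithm 14 (`DotK`) on `x₀y₀ … xₙyₙ` with `K = m + 3 ≥ 3`. Front end (lines 2–6): rounded
products `hᵢ` with exact residuals (`TwoProdFMA`), rounded running sums `pᵢ` of the `hᵢ` with exact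
addition errors (`PriestTwoSum`), giving the `2n + 2` residuals `R 0` of `dotK_sum_residuals_eq`;
then (line 7) `SumK` with `K - 1 = m + 2` on them: `m + 1` passes `R k ↦ R (k+1)` (`IsVecSumPass`
on `2n + 2` entries, running sums `Acc k`) and the final recursive summation (accumulator `σ`,
result `res`). With `8 (n+1) v ≤ 1`:
`|res - xᵀy| ≤ (v + 2γ₄ₙ₊₂(v)²)|xᵀy| + γ₄ₙ₊₂(v)^(m+3) |x|ᵀ|y|` — printed
`(2u + 2γ²₄ₙ₋₂(2u))|xᵀy| + γᴷ₄ₙ₋₂(2u)|xᵀ||y|`, resp. `(u + 2γ²₄ₙ₋₂)|xᵀy| + γᴷ₄ₙ₋₂|xᵀ||y|`.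
Proof as printed: PROPOSITION 7.4 / 7.1 on the residuals, (8.43), (8.49), then `γ ≤ 1`,
`3γ²₂ₙ₊₁ ≤ ¾γ²₄ₙ₊₂`, `γ₂ₙ₊₂ ≤ γ₄ₙ₊₂`.
[cite: GraillatJezequelPicot2018, §8.2 Proposition 8.3, proof (8.42)–(8.49); §8.1
Proposition 8.1, Algorithms 13–14] [cite: OgitaRumpOishi2005] -/
theorem abs_dotK_sub_dot_le {v : K} (hv : 0 ≤ v) {n : ℕ} (hn8 : 8 * (((n + 1 : ℕ) : K) * v) ≤ 1)
    (x y h p : ℕ → K) (hh : ∀ i < n + 1, |h i - x i * y i| ≤ v * |x i * y i|) (hp0 : p 0 = h 0)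
    (hp : ∀ i < n, |p (i + 1) - (p i + h (i + 1))| ≤ v * |p i + h (i + 1)|)
    (R Acc : ℕ → ℕ → K) (hr₁ : ∀ i < n + 1, R 0 i = x i * y i - h i)
    (hr₂ : ∀ i < n, R 0 (n + 1 + i) = p i + h (i + 1) - p (i + 1))
    (hr₃ : R 0 (2 * n + 1) = p n) (m : ℕ)
    (hpass : ∀ k < m + 1, IsVecSumPass v (2 * n + 1) (R k) (Acc k) (R (k + 1)))
    (σ : ℕ → K) (res : K) (hσ0 : σ 0 = 0)
    (hσ : ∀ i < 2 * n + 1, |σ (i + 1) - (σ i + R (m + 1) i)| ≤ v * |σ i + R (m + 1) i|)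
    (hres : |res - (R (m + 1) (2 * n + 1) + σ (2 * n + 1))|
      ≤ v * |R (m + 1) (2 * n + 1) + σ (2 * n + 1)|) :
    |res - ∑ i ∈ range (n + 1), x i * y i|
      ≤ (v + 2 * gamma v (4 * n + 2) ^ 2) * |∑ i ∈ range (n + 1), x i * y i|
        + gamma v (4 * n + 2) ^ (m + 3) * ∑ i ∈ range (n + 1), |x i * y i| := by
  have hv0 : 0 ≤ (n : K) * v := mul_nonneg (Nat.cast_nonneg n) hv
  have hn8' : 8 * (((n : K) + 1) * v) ≤ 1 := by push_cast at hn8; exact hn8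
  have hN4 : 4 * ((((2 * n + 1 : ℕ)) : K) * v) ≤ 1 := by push_cast; nlinarith
  have hn2 : ((2 * n + 2 : ℕ) : K) * v < 1 := by push_cast; nlinarith
  have h4N : ((4 * n + 2 : ℕ) : K) * v < 1 := by push_cast; nlinarith
  have h2N : ((2 * (2 * n + 1) : ℕ) : K) * v < 1 := by push_cast; nlinarith
  have hN : ((2 * n + 1 : ℕ) : K) * v < 1 := by push_cast; nlinarith
  have hΓle1 : gamma v (4 * n + 2) ≤ 1 :=
    gamma_le_one hv (by push_cast; nlinarith)
  -- PROPOSITION 7.4 / 7.1 on the `2n + 2` residuals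
  have hK := abs_sumK_sub_sum_le hv hN4 R Acc m hpass σ res hσ0 hσ hres
  have e0 : 2 * n + 1 + 1 = 2 * n + 2 := rfl
  have e4 : 2 * (2 * n + 1) = 4 * n + 2 := by ring
  rw [e0, e4] at hK
  -- (8.43) and (8.49)
  have hid := dotK_sum_residuals_eq n x y h p (R 0) hp0 hr₁ hr₂ hr₃
  have hS := dotK_sum_abs_residuals_le_gamma hv n hn2 x y h p (R 0) hh hp0 hp hr₁ hr₂ hr₃
  rw [hid] at hK
  set d := ∑ i ∈ range (n + 1), x i * y i
  set T := ∑ i ∈ range (n + 1), |x i * y i|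
  have hγN0 : 0 ≤ gamma v (2 * n + 1) := gamma_nonneg hv hN
  have hΓ0 : 0 ≤ gamma v (4 * n + 2) := gamma_nonneg hv h4N
  have hT0 : 0 ≤ T := Finset.sum_nonneg fun _ _ => abs_nonneg _
  have hd0 := abs_nonneg d
  -- `2γ₂ₙ₊₁ ≤ γ₄ₙ₊₂`, so `3γ²₂ₙ₊₁ ≤ ¾γ²₄ₙ₊₂`
  have hγN : 2 * gamma v (2 * n + 1) ≤ gamma v (4 * n + 2) := by
    have h2 := two_mul_gamma_le_gamma_two_mul hv h2N; rwa [e4] at h2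
  have hsq : gamma v (2 * n + 1) ^ 2 ≤ gamma v (4 * n + 2) ^ 2 / 4 := by
    have h2 := mul_le_mul hγN hγN (mul_nonneg (by norm_num) hγN0) hΓ0
    linarith [h2]
  -- `γ₂ₙ₊₂ ≤ γ₄ₙ₊₂` and `γ₄ₙ₊₂ ≤ 1`
  have hmono : gamma v (2 * n + 2) ≤ gamma v (4 * n + 2) := gamma_mono hv (by omega) h4N
  have hpow1 : gamma v (4 * n + 2) ^ (m + 2) ≤ gamma v (4 * n + 2) ^ 2 :=
    pow_le_pow_of_le_one hΓ0 hΓle1 (by omega)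
  have hpow2 : gamma v (4 * n + 2) ^ (m + 2) * gamma v (2 * n + 2)
      ≤ gamma v (4 * n + 2) ^ (m + 3) := by
    rw [show gamma v (4 * n + 2) ^ (m + 3) = gamma v (4 * n + 2) ^ (m + 2) * gamma v (4 * n + 2)
      from pow_succ _ _]
    exact mul_le_mul_of_nonneg_left hmono (pow_nonneg hΓ0 _)
  have step1 : gamma v (4 * n + 2) ^ (m + 2) * ∑ i ∈ range (2 * n + 2), |R 0 i|
      ≤ gamma v (4 * n + 2) ^ (m + 2) * (|d| + gamma v (2 * n + 2) * T) :=
    mul_le_mul_of_nonneg_left hS (pow_nonneg hΓ0 _)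
  have step2 : gamma v (4 * n + 2) ^ (m + 2) * |d| ≤ gamma v (4 * n + 2) ^ 2 * |d| :=
    mul_le_mul_of_nonneg_right hpow1 hd0
  have step3 : gamma v (4 * n + 2) ^ (m + 2) * gamma v (2 * n + 2) * T
      ≤ gamma v (4 * n + 2) ^ (m + 3) * T :=
    mul_le_mul_of_nonneg_right hpow2 hT0
  have step4 : gamma v (2 * n + 1) ^ 2 * |d| ≤ gamma v (4 * n + 2) ^ 2 / 4 * |d| :=
    mul_le_mul_of_nonneg_right hsq hd0
  linarith [hK, step1, step2, step3, step4, mul_nonneg (sq_nonneg (gamma v (4 * n + 2))) hd0]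

/-- COROLLARY 8.4 (`v = 2u`) / COROLLARY 8.2 ([20], `v = u`): the relative form of
PROPOSITION 8.3 / 8.1, `|res - xᵀy| / |xᵀy| ≤ v + 2γ₄ₙ₊₂(v)² + ½γ₄ₙ₊₂(v)^(m+3) cond(xᵀy)` with
`cond(xᵀy) = 2|x|ᵀ|y| / |xᵀy|` (junk value `x / 0 = 0` when `xᵀy = 0`).
[cite: GraillatJezequelPicot2018, §8.2 Corollary 8.4; §8.1 Corollary 8.2]
[cite: OgitaRumpOishi2005] -/
theorem abs_dotK_sub_dot_div_le {v : K} (hv : 0 ≤ v) {n : ℕ}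
    (hn8 : 8 * (((n + 1 : ℕ) : K) * v) ≤ 1)
    (x y h p : ℕ → K) (hh : ∀ i < n + 1, |h i - x i * y i| ≤ v * |x i * y i|) (hp0 : p 0 = h 0)
    (hp : ∀ i < n, |p (i + 1) - (p i + h (i + 1))| ≤ v * |p i + h (i + 1)|)
    (R Acc : ℕ → ℕ → K) (hr₁ : ∀ i < n + 1, R 0 i = x i * y i - h i)
    (hr₂ : ∀ i < n, R 0 (n + 1 + i) = p i + h (i + 1) - p (i + 1))
    (hr₃ : R 0 (2 * n + 1) = p n) (m : ℕ)
    (hpass : ∀ k < m + 1, IsVecSumPass v (2 * n + 1) (R k) (Acc k) (R (k + 1)))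
    (σ : ℕ → K) (res : K) (hσ0 : σ 0 = 0)
    (hσ : ∀ i < 2 * n + 1, |σ (i + 1) - (σ i + R (m + 1) i)| ≤ v * |σ i + R (m + 1) i|)
    (hres : |res - (R (m + 1) (2 * n + 1) + σ (2 * n + 1))|
      ≤ v * |R (m + 1) (2 * n + 1) + σ (2 * n + 1)|) :
    |res - ∑ i ∈ range (n + 1), x i * y i| / |∑ i ∈ range (n + 1), x i * y i|
      ≤ v + 2 * gamma v (4 * n + 2) ^ 2
        + gamma v (4 * n + 2) ^ (m + 3) / 2
          * (2 * (∑ i ∈ range (n + 1), |x i * y i|) / |∑ i ∈ range (n + 1), x i * y i|) := by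
  have hmain := abs_dotK_sub_dot_le hv hn8 x y h p hh hp0 hp R Acc hr₁ hr₂ hr₃ m hpass σ res hσ0
    hσ hres
  set d := ∑ i ∈ range (n + 1), x i * y i
  set T := ∑ i ∈ range (n + 1), |x i * y i|
  rcases eq_or_lt_of_le (abs_nonneg d) with hd | hd
  · rw [← hd]
    simp only [div_zero, mul_zero, add_zero]
    linarith [sq_nonneg (gamma v (4 * n + 2))]
  · rw [div_le_iff₀ hd]
    have h3 : gamma v (4 * n + 2) ^ (m + 3) / 2 * (2 * T / |d|) * |d|
        = gamma v (4 * n + 2) ^ (m + 3) * T := by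
      rw [mul_assoc, div_mul_cancel₀ _ (ne_of_gt hd)]; ring
    linarith [hmain, h3]

end Literature.ComputerArithmetic.GraillatJezequelPicot2018
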